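import Summits.RiemannHypothesis.RiemannHypothesis.Theorems.HardyZLehmerSplitSigmaLLaguerreCone
import Summits.RiemannHypothesis.RiemannHypothesis.Theorems.HardyZLehmerSplitSigmaLLaguerreOfOnLine
import Summits.RiemannHypothesis.RiemannHypothesis.Theorems.HardyZLehmerSplitDictionaryCrux
import Summits.RiemannHypothesis.RiemannHypothesis.Theses.HardyZLehmerSplit
import HarnessLib

/-!
# Crux `SigmaL` (stmt-RiemannHypothesis-24253) — what the cone theorem makes of the crux: reductions
# BY NAME, the unit-padding seam at the Platt–Trudgian height, and the bracket RH ⇒ Σ_L ⇒ ¬(thin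
# isolated off-line pairs)

Companion of `Theorems/HardyZLehmerSplitSigmaLLaguerreCone.lean` (the RH-free CONE THEOREM
`laguerreAtCritical_of_offCone`: at a critical point `t ≥ 3·10¹²` of Hardy's `Z` with `Z(t) ≠ 0`,
`Z(t)·Z''(t) < 0` unless an OFF-line zero `β + iγ` of `ζ` has `|γ − t| ≤ 2|β − ½|`). This module needs
the route file (the crux `SigmaL` and the cite conjunct are named) and records:

* §7 the registered stub `stub_laguerreAtCritical` and the crux `SigmaL` BY NAME from "the critical
  points / wrong-sign candidates of `Z` above `3·10¹²` avoid the doubled cones of off-line zeros"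
  (`laguerreAtCritical_of_conesAvoidCritical`, `SigmaL_of_conesAvoidExtrema`) — REDUCTIONS under an
  unregistered hypothesis that is RH-strength as a whole (each off-line zero's cone covers its own
  ordinate) but says WHERE the crux can fail;
* §8 the seam with unit padding: granted the cite fact `platt_trudgian_numerical_rh` (the route's
  `HeightPT`), stub and crux hold on `(3·10¹², H₀ − 1)` (was `H₀ − 8`) and reduce to their parts at
  `t ≥ H₀ − 1 = 3 000 175 332 799` (`laguerreAtCritical_belowPT'`, `noViolation_belowPT'`,
  `SigmaL_of_platt_trudgian_of_above'`, `SigmaL_of_platt_trudgian_of_conesAvoidExtrema_above`,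
  `laguerreAtCritical_of_platt_trudgian_of_above'`);
* §9 the bracket, by name: `RiemannHypothesis ⇒ SigmaL` (`SigmaL_of_riemannHypothesis`, from
  `laguerreAtCritical_of_riemannHypothesis`) and `SigmaL ⇒` "no very thin, pair-isolated off-line pair
  above `H₀`" (`not_thinIsolated_of_SigmaL`, from the PROVED crux `Dictionary`,
  `DictionaryAssembly.dictionary_crux`); hence, granted `HeightPT` and the declared residual
  `SigmaRest`, `SigmaL ↔ RiemannHypothesis` (`SigmaL_iff_riemannHypothesis_of_heightPT_sigmaRest`, the
  route's `closes` read backwards).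

NOTHING HERE PROVES OR ASSUMES RH; `SigmaL` and `stub_laguerreAtCritical` stay OPEN (RH-strength above
`H₀ − 1`). References: Ivić 2003 §2 Prop. 1 [Ivic2003]; Platt–Trudgian 2021 Thm 1 [PlattTrudgian2021].
-/

set_option linter.dupNamespace false
set_option autoImplicit false

noncomputable section

open Complex Filter Set
open scoped Real Topology
open Literature.NumberTheory.LFunctions
open Summit.RiemannHypothesis.RiemannHypothesis.Theorems.SigmaLRung
open Summit.RiemannHypothesis.RiemannHypothesis.Theses.HardyZLehmerSplit (SigmaL HeightPT SigmaRest
  Dictionary closes)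

namespace Summit.RiemannHypothesis.RiemannHypothesis.Theorems.SigmaLBirth

/-! ## §7. Reductions of the stub and of the crux `SigmaL` (by name) to the cone picture -/

/-- **The stub `stub_laguerreAtCritical` from "critical points avoid the doubled cones":** if for
every `t > 3·10¹²` with `Z'(t) = 0`, `Z(t) ≠ 0` every zero `β + iγ` of `ζ` with `|γ − t| < 1` is on
the line or has `2|β − ½| < |γ − t|`, then the registered stub statement holds verbatim. A REDUCTION
(the hypothesis is RH-strength as a whole and unregistered); credits nothing toward closing the stub;
nothing here bears on the truth of RH. -/
theorem laguerreAtCritical_of_conesAvoidCritical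
    (h : ∀ t : ℝ, 3000000000000 < t → deriv hardyZ t = 0 → hardyZ t ≠ 0 →
      ∀ s : ℂ, riemannZeta s = 0 → |s.im - t| < 1 → s.re = 1 / 2 ∨ 2 * |s.re - 1 / 2| < |s.im - t|) :
    ∀ t : ℝ, 3000000000000 < t → deriv hardyZ t = 0 → hardyZ t ≠ 0 →
      hardyZ t * deriv (deriv hardyZ) t < 0 :=
  fun t ht hd hZ ↦ laguerreAtCritical_of_offCone ht.le (h t ht hd hZ) hd hZ

/-- **The crux `SigmaL` BY NAME from "wrong-sign candidates avoid the doubled cones":** if for every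
`t > 3·10¹²` at which `Z` has a local extremum with `Z(t) ≠ 0`, every zero `β + iγ` of `ζ` with
`|γ − t| < 1` is on the line or has `2|β − ½| < |γ − t|`, then `SigmaL` holds. A REDUCTION under an
unregistered, RH-strength hypothesis (every off-line zero's cone covers its own ordinate, so as a
whole this is of the strength of RH above `3·10¹²`), recording WHERE the crux can fail: only beneath
off-line zeros. Credits nothing; nothing here bears on the truth of RH. -/
theorem SigmaL_of_conesAvoidExtrema
    (h : ∀ t : ℝ, 3000000000000 < t → (IsLocalMin hardyZ t ∨ IsLocalMax hardyZ t) → hardyZ t ≠ 0 →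
      ∀ s : ℂ, riemannZeta s = 0 → |s.im - t| < 1 → s.re = 1 / 2 ∨ 2 * |s.re - 1 / 2| < |s.im - t|) :
    Summit.RiemannHypothesis.RiemannHypothesis.Theses.HardyZLehmerSplit.SigmaL := by
  intro t ht
  refine ⟨fun hmin ↦ ?_, fun hmax ↦ ?_⟩
  · by_contra hpos
    push Not at hpos
    exact absurd ((noViolationAt_of_offCone ht.le (h t ht (Or.inl hmin) hpos.ne')).1 hmin)
      (not_le.2 hpos)
  · by_contra hneg
    push Not at hneg
    exact absurd ((noViolationAt_of_offCone ht.le (h t ht (Or.inr hmax) hneg.ne)).2 hmax)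
      (not_le.2 hneg)

/-! ## §8. Below the Platt–Trudgian height with unit padding; the residual above `H₀ − 1` -/

/-- **In-regime instance with unit padding:** granted the cite fact
`Literature.NumberTheory.LFunctions.platt_trudgian_numerical_rh` (Platt–Trudgian 2021 Thm 1: every
zero with `0 < γ ≤ H₀ = 3 000 175 332 800` is on the line — the route's `HeightPT` conjunct, NOT proved
in the tree), the Laguerre inequality at critical points of `Z` holds on `(3·10¹², H₀ − 1)` (was
`(3·10¹², H₀ − 8)`, `laguerreAtCritical_belowPT`): so the RH-free OPEN part of the stub is exactly
`t ≥ H₀ − 1`. CONDITIONAL on the cite fact; nothing here bears on the truth of RH.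
[cite: PlattTrudgian2021, Theorem 1] -/
theorem laguerreAtCritical_belowPT' (hPT : platt_trudgian_numerical_rh) :
    ∀ t : ℝ, 3000000000000 < t → t < 3000175332799 → deriv hardyZ t = 0 → hardyZ t ≠ 0 →
      hardyZ t * deriv (deriv hardyZ) t < 0 :=
  laguerreAtCritical_of_onLine' (A' := 3000000000000 - 1) (B' := 3000175332800)
    le_rfl le_rfl (by norm_num) (fun s hs h1 h2 ↦ hPT s hs (by linarith) h2.le)

/-- **In-regime Σ_L with unit padding:** granted `platt_trudgian_numerical_rh`, Hardy's `Z` has no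
positive local minimum and no negative local maximum on `(3·10¹², H₀ − 1)` (was `H₀ − 8`,
`noViolation_belowPT`). CONDITIONAL on the cite fact; nothing here bears on the truth of RH.
[cite: PlattTrudgian2021, Theorem 1] -/
theorem noViolation_belowPT' (hPT : platt_trudgian_numerical_rh) :
    ∀ t : ℝ, 3000000000000 < t → t < 3000175332799 →
      (IsLocalMin hardyZ t → hardyZ t ≤ 0) ∧ (IsLocalMax hardyZ t → 0 ≤ hardyZ t) :=
  noViolationOn_of_onLine' (A' := 3000000000000 - 1) (B' := 3000175332800)
    le_rfl le_rfl (by norm_num) (fun s hs h1 h2 ↦ hPT s hs (by linarith) h2.le)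

/-- **The crux `SigmaL` reduces, granted the cite fact `platt_trudgian_numerical_rh`, to its part at
`t ≥ H₀ − 1`** (was `H₀ − 9`, `SigmaL_of_platt_trudgian_of_above`): no positive local minimum /
negative local maximum of `Z` at any `t ≥ 3 000 175 332 799` implies `SigmaL`. The crux BY NAME under
an unregistered hypothesis — a REDUCTION that credits nothing; CONDITIONAL on the cite fact; nothing
here bears on the truth of RH. [cite: PlattTrudgian2021, Theorem 1] -/
theorem SigmaL_of_platt_trudgian_of_above' (hPT : platt_trudgian_numerical_rh)
    (habove : ∀ t : ℝ, 3000175332799 ≤ t →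
      (IsLocalMin hardyZ t → hardyZ t ≤ 0) ∧ (IsLocalMax hardyZ t → 0 ≤ hardyZ t)) :
    Summit.RiemannHypothesis.RiemannHypothesis.Theses.HardyZLehmerSplit.SigmaL := by
  intro t ht
  by_cases h : t < 3000175332799
  · exact noViolation_belowPT' hPT t ht h
  · exact habove t (by linarith)

/-- **The sharpest typed residual of the crux:** granted `platt_trudgian_numerical_rh`, `SigmaL`
follows from "for every `t ≥ H₀ − 1` at which `Z` has a local extremum with `Z(t) ≠ 0`, every zero
`β + iγ` of `ζ` with `|γ − t| < 1` is on the line or has `2|β − ½| < |γ − t|`" — i.e. ABOVE the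
verified height, the wrong-sign candidates of `Z` avoid the doubled cones of off-line zeros. The crux
BY NAME; a REDUCTION under an unregistered RH-strength hypothesis, CONDITIONAL on the cite fact;
credits nothing; nothing here bears on the truth of RH. [cite: PlattTrudgian2021, Theorem 1] -/
theorem SigmaL_of_platt_trudgian_of_conesAvoidExtrema_above (hPT : platt_trudgian_numerical_rh)
    (habove : ∀ t : ℝ, 3000175332799 ≤ t → (IsLocalMin hardyZ t ∨ IsLocalMax hardyZ t) →
      hardyZ t ≠ 0 → ∀ s : ℂ, riemannZeta s = 0 → |s.im - t| < 1 →
        s.re = 1 / 2 ∨ 2 * |s.re - 1 / 2| < |s.im - t|) :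
    Summit.RiemannHypothesis.RiemannHypothesis.Theses.HardyZLehmerSplit.SigmaL := by
  refine SigmaL_of_platt_trudgian_of_above' hPT fun t ht ↦ ⟨fun hmin ↦ ?_, fun hmax ↦ ?_⟩
  · by_contra hpos
    push Not at hpos
    exact absurd ((noViolationAt_of_offCone (by linarith)
      (habove t ht (Or.inl hmin) hpos.ne')).1 hmin) (not_le.2 hpos)
  · by_contra hneg
    push Not at hneg
    exact absurd ((noViolationAt_of_offCone (by linarith)
      (habove t ht (Or.inr hmax) hneg.ne)).2 hmax) (not_le.2 hneg)

/-- **The stub reduces, granted `platt_trudgian_numerical_rh`, to its part at `t ≥ H₀ − 1`** (was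
`H₀ − 9`, `laguerreAtCritical_of_platt_trudgian_of_above`). CONDITIONAL on the cite fact; a reduction,
not a proof of the stub; nothing here bears on the truth of RH. [cite: PlattTrudgian2021, Theorem 1] -/
theorem laguerreAtCritical_of_platt_trudgian_of_above' (hPT : platt_trudgian_numerical_rh)
    (habove : ∀ t : ℝ, 3000175332799 ≤ t → deriv hardyZ t = 0 → hardyZ t ≠ 0 →
      hardyZ t * deriv (deriv hardyZ) t < 0) :
    ∀ t : ℝ, 3000000000000 < t → deriv hardyZ t = 0 → hardyZ t ≠ 0 →
      hardyZ t * deriv (deriv hardyZ) t < 0 := by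
  intro t ht hd hZ
  by_cases h : t < 3000175332799
  · exact laguerreAtCritical_belowPT' hPT t ht h hd hZ
  · exact habove t (by linarith) hd hZ

/-! ## §9. The bracket `RH ⇒ Σ_L ⇒ ¬(thin isolated off-line pairs above H₀)`, by name -/

/-- **`RiemannHypothesis ⇒ SigmaL`, by name** (the crux is RH-implied: `laguerreAtCritical_of_riemannHypothesis`
+ `SigmaL_of_laguerreAtCritical`; Ivić 2003 §2 Prop. 1 made effective above `3·10¹²`). CONDITIONAL on RH —
credits nothing toward the crux; nothing here bears on the truth of RH. [cite: Ivic2003, §2 Prop. 1] -/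
theorem SigmaL_of_riemannHypothesis (hRH : RiemannHypothesis) :
    Summit.RiemannHypothesis.RiemannHypothesis.Theses.HardyZLehmerSplit.SigmaL :=
  SigmaL_of_laguerreAtCritical (laguerreAtCritical_of_riemannHypothesis hRH)

/-- **`SigmaL ⇒` no very thin, pair-isolated off-line pair above `H₀`** (unconditional implication,
from the PROVED crux `Dictionary` = `DictionaryAssembly.dictionary_crux`: such a pair `½ ± δ + iγ`,
`γ > H₀`, `δ·log²γ ≤ ¼`, isolated at radius `π/log γ`, forces a Lehmer violation at some `t` with
`|t − γ| < π/log γ < 1`, which `SigmaL` forbids). The RH-free CONSEQUENCE side of the bracket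
`RH ⇒ SigmaL ⇒ ¬(thin isolated pairs)`; nothing here bears on the truth of RH. -/
theorem not_thinIsolated_of_SigmaL
    (hL : Summit.RiemannHypothesis.RiemannHypothesis.Theses.HardyZLehmerSplit.SigmaL) :
    ∀ γ δ : ℝ, 3000175332800 < γ → 0 < δ → δ < 1 / 2 →
      riemannZeta (1 / 2 + δ + γ * Complex.I) = 0 → δ * Real.log γ ^ 2 ≤ 1 / 4 →
      (∀ s : ℂ, riemannZeta s = 0 → 0 < s.re → s.re < 1 → |s.im - γ| < Real.pi / Real.log γ →
        s.im = γ ∧ (s.re = 1 / 2 + δ ∨ s.re = 1 / 2 - δ)) → False := by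
  intro γ δ hγ hδ hδ' hz hthin hiso
  obtain ⟨t, ht, hv⟩ := DictionaryAssembly.dictionary_crux γ δ hγ hδ hδ' hz hthin hiso
  have hγpos : (0 : ℝ) < γ := by linarith
  have hlog : Real.pi < Real.log γ := by
    have h4 : Real.pi < 4 := Real.pi_lt_four
    have hexp : Real.exp 4 < γ := by
      have h16 : Real.exp 4 = Real.exp 1 ^ 4 := by
        rw [← Real.exp_nat_mul]; norm_num
      have h3 : Real.exp 1 < 3 := by linarith [Real.exp_one_lt_d9]
      have h81 : Real.exp 1 ^ 4 < 3 ^ 4 := by gcongr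
      rw [h16]
      linarith
    have := Real.log_lt_log (Real.exp_pos 4) hexp
    rw [Real.log_exp] at this
    linarith
  have hr : Real.pi / Real.log γ < 1 := by
    rw [div_lt_one (Real.pi_pos.trans hlog)]
    exact hlog
  have ht' : (3000000000000 : ℝ) < t := by
    have := (abs_lt.1 (ht.trans hr)).1
    linarith
  have hLt := hL t ht'
  rcases hv with ⟨hmin, hpos⟩ | ⟨hmax, hneg⟩
  · exact absurd (hLt.1 hmin) (not_le.2 hpos)
  · exact absurd (hLt.2 hmax) (not_le.2 hneg)

/-- **Granted `HeightPT` and the declared residual `SigmaRest`, `SigmaL ↔ RiemannHypothesis`** (the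
route's deciding theorem `closes` with the proved crux `Dictionary`, read in both directions: `→` is
`closes`, `←` is `SigmaL_of_riemannHypothesis`). CONDITIONAL bookkeeping on two RH-strength/cite
hypotheses; it says the split is TIGHT at `SigmaL` (nothing weaker than RH-above-`H₀` is being asked of
it, modulo the residual), not that anything is proved; nothing here bears on the truth of RH. -/
theorem SigmaL_iff_riemannHypothesis_of_heightPT_sigmaRest
    (hH : Summit.RiemannHypothesis.RiemannHypothesis.Theses.HardyZLehmerSplit.HeightPT)
    (hR : Summit.RiemannHypothesis.RiemannHypothesis.Theses.HardyZLehmerSplit.SigmaRest) :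
    Summit.RiemannHypothesis.RiemannHypothesis.Theses.HardyZLehmerSplit.SigmaL ↔ RiemannHypothesis :=
  ⟨fun hL ↦ Summit.RiemannHypothesis_iff.1 (closes hH hL DictionaryAssembly.dictionary_crux hR),
    SigmaL_of_riemannHypothesis⟩

/-! ## §10. The gap between the stub and the crux: degenerate critical points only -/

/-- **No Lehmer violation at `t` ⇒ the WEAK Laguerre inequality at `t`:** if a local minimum of `Z`
at `t` has `Z(t) ≤ 0` and a local maximum has `Z(t) ≥ 0`, then at `t`, `Z'(t) = 0`, `Z(t) ≠ 0`
imply `Z(t)·Z''(t) ≤ 0` — for `Z·Z'' > 0` would make `t` a strict wrong-sign local extremum by the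
second-derivative test (Mathlib `isLocalMin_of_deriv_deriv_pos` / `isLocalMax_of_deriv_deriv_neg`).
So the registered stub (`Z·Z'' < 0`, strict) exceeds the crux's clause at `t` exactly by the
DEGENERATE critical points `Z' = Z'' = 0 ≠ Z`. Unconditional calculus; nothing here bears on the
truth of RH. [folklore] -/
theorem weakLaguerreAt_of_noViolationAt {t : ℝ}
    (h : (IsLocalMin hardyZ t → hardyZ t ≤ 0) ∧ (IsLocalMax hardyZ t → 0 ≤ hardyZ t))
    (hd : deriv hardyZ t = 0) (hZ : hardyZ t ≠ 0) :
    hardyZ t * deriv (deriv hardyZ) t ≤ 0 := by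
  by_contra hpos
  push Not at hpos
  have hc : ContinuousAt hardyZ t := continuous_hardyZ.continuousAt
  rcases lt_or_gt_of_ne hZ with hneg | hposZ
  · -- `Z(t) < 0`, so `Z''(t) < 0`: a strict negative local maximum
    have hdd : deriv (deriv hardyZ) t < 0 := by
      by_contra hge
      push Not at hge
      have := mul_nonpos_of_nonpos_of_nonneg hneg.le hge
      linarith
    exact absurd (h.2 (isLocalMax_of_deriv_deriv_neg hdd hd hc)) (not_le.2 hneg)
  · -- `Z(t) > 0`, so `Z''(t) > 0`: a strict positive local minimum
    have hdd : 0 < deriv (deriv hardyZ) t := by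
      by_contra hle
      push Not at hle
      have := mul_nonpos_of_nonneg_of_nonpos hposZ.le hle
      linarith
    exact absurd (h.1 (isLocalMin_of_deriv_deriv_pos hdd hd hc)) (not_le.2 hposZ)

/-- **`SigmaL ⇒` the weak Laguerre inequality at every critical point above `3·10¹²`:** under the
crux, `Z'(t) = 0`, `Z(t) ≠ 0`, `t > 3·10¹²` give `Z(t)·Z''(t) ≤ 0`. With
`SigmaL_of_laguerreAtCritical` (`Z·Z'' < 0` ⇒ `SigmaL`) this brackets the crux between the strict
and the weak Laguerre inequality at critical points: the stub `stub_laguerreAtCritical` is `SigmaL`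
plus non-degeneracy (`Z'' ≠ 0`) of the critical points with `Z ≠ 0`. A REFORMULATION aid for the
planner; credits nothing; nothing here bears on the truth of RH. [folklore] -/
theorem weakLaguerreAtCritical_of_SigmaL
    (hL : Summit.RiemannHypothesis.RiemannHypothesis.Theses.HardyZLehmerSplit.SigmaL) :
    ∀ t : ℝ, 3000000000000 < t → deriv hardyZ t = 0 → hardyZ t ≠ 0 →
      hardyZ t * deriv (deriv hardyZ) t ≤ 0 :=
  fun t ht hd hZ ↦ weakLaguerreAt_of_noViolationAt (hL t ht) hd hZ

/-- **The stub ⇔ `SigmaL` ∧ non-degeneracy**: `stub_laguerreAtCritical`'s statement holds iff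
`SigmaL` holds and every critical point `t > 3·10¹²` of `Z` with `Z(t) ≠ 0` has `Z''(t) ≠ 0`.
(`→`: `SigmaL_of_laguerreAtCritical` and `Z·Z'' < 0 ⇒ Z'' ≠ 0`; `←`:
`weakLaguerreAtCritical_of_SigmaL` and `Z, Z'' ≠ 0`.) Bookkeeping for the planner — it identifies the
exact excess of the registered stub over the crux; credits nothing; nothing here bears on the truth
of RH. [folklore] -/
theorem laguerreAtCritical_iff_SigmaL_and_nondegenerate :
    (∀ t : ℝ, 3000000000000 < t → deriv hardyZ t = 0 → hardyZ t ≠ 0 →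
      hardyZ t * deriv (deriv hardyZ) t < 0) ↔
    (Summit.RiemannHypothesis.RiemannHypothesis.Theses.HardyZLehmerSplit.SigmaL ∧
      ∀ t : ℝ, 3000000000000 < t → deriv hardyZ t = 0 → hardyZ t ≠ 0 →
        deriv (deriv hardyZ) t ≠ 0) := by
  constructor
  · intro h
    refine ⟨SigmaL_of_laguerreAtCritical h, fun t ht hd hZ hdd ↦ ?_⟩
    have := h t ht hd hZ
    rw [hdd, mul_zero] at this
    exact lt_irrefl _ this
  · rintro ⟨hL, hnd⟩ t ht hd hZ
    have hle := weakLaguerreAtCritical_of_SigmaL hL t ht hd hZ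
    have hne : hardyZ t * deriv (deriv hardyZ) t ≠ 0 := mul_ne_zero hZ (hnd t ht hd hZ)
    exact lt_of_le_of_ne hle hne

end Summit.RiemannHypothesis.RiemannHypothesis.Theorems.SigmaLBirth

end
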